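import Literature.Computability.Cryptography.LiuPassPadding
import Literature.Computability.Cryptography.LiuPassDistProgram
import Literature.Computability.Complexity.UnaryLeBinary
import Literature.Computability.Complexity.TM2PassThrough
import Literature.Computability.Complexity.CountingHierarchyPPoly
import HarnessLib

/-!
# Discharge of the two efficiency facts of `LiuPassPadding.lean`

`LiuPassPadding.lean` proves the forward direction of Liu–Pass's
`OWFExist_iff_isMildlyHardOnAverage_liuPassKt` (S02) from Thm 5.5 as printed and two
efficiency facts (D-0014), vendored there as named `Prop`s. This file proves both:

* `passThrough_polyTime_holds : passThrough_polyTime` — a polynomial-time map is computed "in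
  front of" an untouched suffix in time independent of the suffix, by the pass-through stack
  machine of `TM2PassThrough.lean` (`TM2Pass.exists_passThrough`, header `TM2Pass.passHdr` of
  length `≤ 2⌊log₂ n⌋ + 4`);
* `lpAdvRun_polyTime_holds : lpAdvRun_polyTime` — the deterministic core of the padding
  distinguisher `lpAdvDist` is polynomial time. The string function behind it is assembled from
  `FP` bricks (`lpDistFn`): reassociate the input `⟨z, r⟩ ↦ ⟨a, ⟨y, r⟩⟩` (`assocFn` of
  `CountingHierarchyPPoly.lean`, `assocFn_boolPair_left`); the stack program of
  `LiuPassDistProgram.lean` (`lpPreFn`: lengths, `Q(n)`, `Q(n+1)`, `K(n)`, the division with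
  remainder of the coin count, the padded sample `x = y ‖ r ↾ t`, the coins `ρ`, the threshold
  `|x| - 3⌊log₂ n⌋` in unary); the heuristic `ℋ` on `⟨x, ρ⟩` in the second component
  (`mapSndFn`, its output `encodeNat (ℋ(x; ρ))`); the unary/binary threshold test of
  `UnaryLeBinary.lean` (`unLeBinFn`). Composition is `PolyTimeComputable.comp_holds`; the passage
  between the pair presentation `(p ↦ boolPair p.1 p.2, encodeBool)` and string functions is the
  total decoder `boolUnpair` (`polyTimeComputable_boolUnpair`).

With these, the forward direction of S02 rests on Thm 5.5 alone
(`isMildlyHardOnAverage_liuPassKt_of_OWFExist_of_h55`), and S02 on Thm 5.5, Yao's amplification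
and the two efficiency facts of Thm 4.1 (`OWFExist_iff_isMildlyHardOnAverage_liuPassKt_of_four`).

## References

* Y. Liu, R. Pass, *On one-way functions and Kolmogorov complexity*, FOCS 2020
  (arXiv:2009.11514), proof of Thm 5.2 (the distinguisher), proofs of Thms 5.5–5.6 (padding).
* S. Arora, B. Barak, *Computational Complexity: A Modern Approach*, CUP 2009, §1.3, Thm. 2.8
  (composition of polynomial-time machines), §7.1.
-/

namespace Literature.Computability.Cryptography

open _root_.Computability

/-! ### The distinguisher as a string function -/

/-- `assocFn ⟨z, r⟩ = ⟨(boolUnpair z).1, ⟨(boolUnpair z).2, r⟩⟩` for an arbitrary first component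
(`CountingHierarchyPPoly.assocFn_boolPair` is the case of a pair `z = ⟨a, b⟩`). [folklore] -/
theorem assocFn_boolPair_left (z r : List Bool) :
    Complexity.assocFn (Complexity.boolPair z r) = Complexity.boolPair (Complexity.boolUnpair z).1 (Complexity.boolPair (Complexity.boolUnpair z).2 r) := by
  simp [Complexity.assocFn, Function.comp_apply, Complexity.copyFn_apply, Complexity.mapFstFn_boolPair, Complexity.mapSndFn_boolPair]

/-- **The padding distinguisher as a string function** on `⟨z, r⟩` (input `z`, coins `r`), for a
string function `h` playing `⟨x, ρ⟩ ↦ encodeNat (ℋ(x; ρ))`: reassociate, preprocess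
(`lpPreFn`), run `h` on the second component, threshold test (`unLeBinFn`).
[Y. Liu, R. Pass, FOCS 2020, proof of Thm 5.2] [cite: LiuPassFOCS2020, Thm 5.2 (proof)] -/
noncomputable def lpDistFn (γ : ℕ) (Q K : Polynomial ℕ) (h : List Bool → List Bool) : List Bool → List Bool :=
  Complexity.unLeBinFn ∘ Complexity.mapSndFn h ∘ lpPreFn γ Q K ∘ Complexity.assocFn

/-- **`lpDistFn γ Q K h ∈ FP` for `h ∈ FP`.** [cite: AroraBarakCC2009, Thm. 2.8] -/
theorem lpDistFn_mem_FP (γ : ℕ) (Q K : Polynomial ℕ) {h : List Bool → List Bool} (hh : h ∈ Complexity.FP) :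
    lpDistFn γ Q K h ∈ Complexity.FP :=
  Complexity.PolyTimeComputable.comp_holds Complexity.unLeBinFn_mem_FP
    (Complexity.PolyTimeComputable.comp_holds (Complexity.mapSndFn_mem_FP hh)
      (Complexity.PolyTimeComputable.comp_holds (lpPreFn_mem_FP γ Q K) Complexity.assocFn_mem_FP))

/-- **Value of the distinguisher function**: with `n = |(boolUnpair z).1|`, `y = (boolUnpair z).2`,
`t = (Q(n) - γ - 1 + ⌊(|r| - Q(n+1)) / K(n)⌋) - n`, `x = y ‖ r ↾ t`,
`ρ = r ⇂ (|r| - (|r| - Q(n+1)) mod K(n))` and `h ⟨x, ρ⟩ = encodeNat v`, the output is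
`[ |x| - 3⌊log₂ n⌋ ≤ v ]`. [Y. Liu, R. Pass, FOCS 2020, proof of Thm 5.2] [cite: LiuPassFOCS2020, Thm 5.2 (proof)] -/
theorem lpDistFn_boolPair (γ : ℕ) (Q K : Polynomial ℕ) (h : List Bool → List Bool) (z r : List Bool) (v : ℕ)
    (hv : h (Complexity.boolPair ((Complexity.boolUnpair z).2 ++ r.take (LPD.tOf γ (Complexity.boolUnpair z).1.length r.length
        (Q.eval (Complexity.boolUnpair z).1.length) (Q.eval ((Complexity.boolUnpair z).1.length + 1)) (K.eval (Complexity.boolUnpair z).1.length)))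
        (r.drop (r.length - (r.length - Q.eval ((Complexity.boolUnpair z).1.length + 1)) % K.eval (Complexity.boolUnpair z).1.length))) =
      encodeNat v) :
    lpDistFn γ Q K h (Complexity.boolPair z r) =
      [decide (((Complexity.boolUnpair z).2 ++ r.take (LPD.tOf γ (Complexity.boolUnpair z).1.length r.length
        (Q.eval (Complexity.boolUnpair z).1.length) (Q.eval ((Complexity.boolUnpair z).1.length + 1)) (K.eval (Complexity.boolUnpair z).1.length))).length -
          3 * Nat.log 2 (Complexity.boolUnpair z).1.length ≤ v)] := by
  simp only [lpDistFn, Function.comp_apply, assocFn_boolPair_left, lpPreFn_boolPair, Complexity.mapSndFn_boolPair, hv,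
    Complexity.unLeBinFn_boolPair, List.length_replicate]

end Literature.Computability.Cryptography

namespace Literature.Computability.Cryptography

open Complexity _root_.Computability Turing

/-! ### The two efficiency facts -/

/-- **Discharge of `passThrough_polyTime`** by the pass-through machine of `TM2PassThrough.lean`
(header `passHdr n`: bit-doubled binary digits of `n` and the separator `01`, of length
`≤ 2⌊log₂ n⌋ + 4`). [cite: LiuPassFOCS2020, Thm 5.6 (proof)] -/
theorem passThrough_polyTime_holds : passThrough_polyTime := by
  intro F hF
  obtain ⟨M, T, h⟩ := TM2Pass.exists_passThrough hF
  exact ⟨TM2Pass.passHdr, 4, M, T, TM2Pass.length_passHdr_le, h⟩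

/-- **Discharge of `lpAdvRun_polyTime`**: the deterministic core of the padding distinguisher is
polynomial time, as the string function `lpDistFn γ Q K h` with
`h = encodeNat ∘ uncurry ℋ.run ∘ boolUnpair` (polynomial time by `IsPPT ℋ encodeNat` and
`polyTimeComputable_boolUnpair`), transported to the pair presentation.
[cite: LiuPassFOCS2020, Thm 5.2 (proof)] -/
theorem lpAdvRun_polyTime_holds : lpAdvRun_polyTime := by
  intro H hH γ Q K
  -- `⟨x, ρ⟩ ↦ encodeNat (ℋ(x; ρ))` is in `FP`
  have h1 : PolyTimeComputable (fun p : List Bool × List Bool => boolPair p.1 p.2) (id : List Bool → List Bool)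
      (fun p : List Bool × List Bool => encodeNat (H.run p.1 p.2)) := by
    obtain ⟨p, M, hM⟩ := hH.1
    exact ⟨p, M, fun a => hM a⟩
  have hh : ((fun p : List Bool × List Bool => encodeNat (H.run p.1 p.2)) ∘ boolUnpair) ∈ FP :=
    PolyTimeComputable.comp_holds h1 polyTimeComputable_boolUnpair
  obtain ⟨p, M, hM⟩ := lpDistFn_mem_FP γ Q K hh
  refine ⟨p, M, fun q => ?_⟩
  have hrun := hM (boolPair q.1 q.2)
  have hval := lpDistFn_boolPair γ Q K ((fun p : List Bool × List Bool => encodeNat (H.run p.1 p.2)) ∘ boolUnpair)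
    q.1 q.2 _ (by rw [Function.comp_apply, boolUnpair_boolPair])
  simp only [id_eq] at hrun
  rw [hval] at hrun
  exact hrun

/-! ### Consequences for S02 -/

/-- **`OWFExist → K^t` is mildly hard on average, for every `U` and every `t ≥ (1+ε)n`, from
Thm 5.5 alone** (the two efficiency facts of `LiuPassPadding.lean` discharged here).
[Y. Liu, R. Pass, FOCS 2020, Thm 3.1 (a)⇒(c) and the remark after Thm 1.1]
[cite: LiuPassFOCS2020, Thm 3.1] -/
theorem isMildlyHardOnAverage_liuPassKt_of_OWFExist_of_h55 (h55 : condEPPRG_of_OWFExist) :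
    isMildlyHardOnAverage_liuPassKt_of_OWFExist :=
  isMildlyHardOnAverage_liuPassKt_of_OWFExist_of_facts h55 passThrough_polyTime_holds lpAdvRun_polyTime_holds

/-- **S02 from four named facts**: the two efficiency facts of Thm 4.1
(`liuPassOWF_polyTimeComputable`, `liuPassHeur_isPPT`, `LiuPassWeakOWF.lean`), Yao's
amplification (`weakOWFExist_iff_OWFExist`, S05) and Thm 5.5 (`condEPPRG_of_OWFExist`).
[Y. Liu, R. Pass, FOCS 2020, Thm 1.1 and the remark after it] [cite: LiuPassFOCS2020, Thm 1.1] -/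
theorem OWFExist_iff_isMildlyHardOnAverage_liuPassKt_of_four
    (hf : liuPassOWF_polyTimeComputable) (hH : liuPassHeur_isPPT) (hYao : weakOWFExist_iff_OWFExist)
    (h55 : condEPPRG_of_OWFExist) : OWFExist_iff_isMildlyHardOnAverage_liuPassKt :=
  OWFExist_iff_isMildlyHardOnAverage_liuPassKt_of_facts' hf hH hYao h55 passThrough_polyTime_holds
    lpAdvRun_polyTime_holds

end Literature.Computability.Cryptography
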